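import Literature.NumberTheory.EllipticCurves.BSDSelmerCMPConverseKLevelProofs
import Literature.NumberTheory.EllipticCurves.MordellWeilRankZeroProofs
import HarnessLib

/-!
# The Yan–Zhu corank-one `p`-converse: its `L`-function-free core (`Ш[p^∞]` finite in corank one)

Sibling proof file (theorems only; no named fact, D-0014/D-0026) of
`Literature.NumberTheory.EllipticCurves.KuriharaNumberKimStructure`, for the named fact
`Literature.NumberTheory.EllipticCurves.yanZhu_analyticRank_eq_one_of_selmerCorank_eq_one`
(X. Yan, X. Zhu, arXiv:2412.20078 = J. Algebra (2026), **Cor. 1.4**, (2) ⟹ (3) at `r = 1`; over the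
auxiliary field this is Burungale–Castella–Grossi–Skinner, Camb. J. Math. 14 (2026) =
arXiv:2312.09301, **Cor. 1**): for `E/ℚ` (globally minimal model `W`), a prime `p ≥ 5` of good
ordinary reduction with `ρ̄_{E,p}` surjective,
`corank_{ℤ_p} Sel_{p^∞}(E/ℚ) = 1 ⟹ ord_{s=1} L(E, s) = 1`.

`BSDSelmerPConverseYanZhuProofs` assembles the fact along its two printed roads (Yan–Zhu §4.6;
BCGS Thm. 1 + Cor. 1), each through four named facts of the tree (parity, modularity,
a non-vanishing twist, Kato) and ONE `K`-level rank-one `p`-converse that the tree does not carry.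
This file records a third reduction, orthogonal to both, which isolates what that `K`-level
theorem contributes over `ℚ` in purely ALGEBRAIC terms — no `L`-function, no auxiliary field, no
Heegner point appears in it:

> (Ш₁) for `W`, `p` as in the fact: `corank_{ℤ_p} Sel_{p^∞}(E/ℚ) = 1 ⟹ Ш(E/ℚ)[p^∞]` is finite;

equivalently (corank identity `corank Sel_{p^∞} = rank + corank Ш[p^∞]`, Greenberg 1999 §1, the
tree THEOREM `WeierstrassCurve.selmerCorank_eq_mordellWeilRank_add_holds`) `rank E(ℚ) = 1`,
equivalently `rank E(ℚ) ≥ 1`, equivalently (Mordell–Weil) `E(ℚ)` is infinite, equivalently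
`rank E(ℚ) = corank_{ℤ_p} Sel_{p^∞}(E/ℚ)`.

## What is proved

* `yanZhu_analyticRank_eq_one_of_selmerCorank_eq_one_of_kim_of_pos_rank` (and the variants
  `…_of_kim_of_finite_sha_primary`, `…_of_kim_of_infinite_point`): **the fact from Kim's Cor. 1.4
  and (Ш₁).** Kim's Cor. 1.4 is the tree fact `kim_analyticRank_eq_one_of_mordellWeilRank_eq_one`
  (C.-H. Kim, Math. Ann. 387 (2022), Cor. 1.4: non-CM `E`, `p > 3` good ordinary, `E[p]`
  irreducible, `rk E(ℚ) = 1`, `#Ш(E/ℚ)[p^∞] < ∞ ⟹ ord_{s=1} L(E, s) = 1`). Proof: the corank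
  identity squeezes `(corank, rank) = (1, ≥ 1)` to `rank = 1`, `corank Ш[p^∞] = 0`, i.e. `Ш[p^∞]`
  finite (`finite_primaryComponent_sha_iff_shaCorank_eq_zero`, which uses `#Ш[p] < ∞`);
  surjectivity of `ρ̄_{E,p}` at a good ordinary `p ≥ 5` makes `E` non-CM
  (`not_hasCM_of_hasSurjectiveModNGaloisRep_of_five_le`, Serre 1972 §4.5) and `E[p]` irreducible
  (`hasIrreducibleModPGaloisRep_of_hasSurjectiveModNGaloisRep`); Kim's Cor. 1.4 concludes.
* `mordellWeilRank_eq_one_and_finite_sha_of_yanZhu_of_gzk`: **conversely** the fact and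
  Gross–Zagier–Kolyvagin over `ℚ` (tree fact `rank_eq_analyticRank_of_analyticRank_le_one`,
  Darmon 2004 Thm. 3.22) give, in corank one, `rank E(ℚ) = 1` and `Ш(E/ℚ)` finite.
* `yanZhu_analyticRank_eq_one_of_selmerCorank_eq_one_iff_finite_sha_primary`, `…_iff_pos_rank`,
  `…_iff_infinite_point`, `…_iff_mordellWeilRank_eq_selmerCorank`: hence, MODULO the two named
  facts (Kim's Cor. 1.4 and Gross–Zagier–Kolyvagin over `ℚ`), the Yan–Zhu fact is EQUIVALENT to
  (Ш₁) in each of its forms.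

## Why this is recorded (barrier bookkeeping, D-0021)

The catalogued barrier `Literature.Barriers.BirchSwinnertonDyer.SelmerRankBarrier`
(`Literature/Barriers/BirchSwinnertonDyer/SelmerVersusMordellWeil.lean`): a Selmer group sees
`rank E(ℚ)` only through `Ш[p^∞]` — `rank ≤ corank Sel_{p^∞}` with equality iff
`corank Ш[p^∞] = 0` (W. Zhang, Camb. J. Math. 2 (2014), p. 193) — and its `evasions_known` line
lists "the `p`-converse theorems that turn `corank Sel_{p^∞} = 1` into a non-torsion Heegner point
WITHOUT assuming `Ш` finite". The equivalences below say that the Yan–Zhu fact IS that evasion at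
corank one, no more and no less (given Kim's Cor. 1.4 and GZK): any proof must produce a rational
point of infinite order — equivalently kill the divisible part of `Ш(E/ℚ)[p^∞]` — from a corank-one
Selmer group. The configuration it excludes, `rank E(ℚ) = 0` with `Ш(E/ℚ)[p^∞] ⊇ ℚ_p/ℤ_p`
("phantom Ш"), is exactly the one out of reach of Kim's Cor. 1.4 (which assumes
`#Ш[p^∞] < ∞`) and of Kim's Thm. 1.1 / Skinner 2020 (hypothesis (res), automatic once
`rank E(ℚ) ≥ 1`); in print the point is the Heegner point `y_K`, made non-torsion by the
non-vanishing of the Heegner-point Kolyvagin system (BCGS Thm. A with Kolyvagin's structure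
theorem; Yan–Zhu §4.6 via the Heegner point main conjecture) — the `K`-level input `hBCGS` / `hL`
of `BSDSelmerPConverseYanZhuProofs`.

Nothing deep is asserted: Kim's Cor. 1.4 and Gross–Zagier–Kolyvagin enter as hypotheses (named
facts of the tree), and the new content is the corank-one squeeze.

## References

* [YanZhu2024MainConjNonCM] X. Yan, X. Zhu, arXiv:2412.20078 = J. Algebra (2026), Cor. 1.4 (§1.1)
  and Thm. 4.15 (§4.6).
* [BurungaleEtAl2026] A. Burungale, F. Castella, G. Grossi, C. Skinner, Camb. J. Math. 14 (2026)
  = arXiv:2312.09301, §0.1, Thm. 1 and Cor. 1 (pp. 3–4), Thm. A.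
* [Kim2022] C.-H. Kim, Math. Ann. 387 (2022), 1961–1968 = arXiv:2109.12344, Thm. 1.1, Cor. 1.4,
  Remark 2.11 (the rôle of (res)).
* [Darmon2004] H. Darmon, CBMS 101 (2004), Thm. 3.22 (Gross–Zagier–Kolyvagin).
* [Greenberg1999LNM] R. Greenberg, LNM 1716 (1999), §1, pp. 54–57 (the corank identity).
* [WZhang2014] W. Zhang, Camb. J. Math. 2 (2014), p. 193 (`0 ≤ r_MW ≤ r_p`, equality iff
  `Ш[p^∞]` finite) and Thms. 1.3–1.4.
* [SilvermanAEC2009] J. H. Silverman, AEC, Thm. VIII.6.7 (Mordell–Weil: `rank = 0 ↔ E(K)` finite).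
-/

noncomputable section

open scoped Classical

open WeierstrassCurve

universe u

namespace Literature.NumberTheory.EllipticCurves

/-! ### The corank-one squeeze (any number field) -/

section Squeeze

variable {K : Type u} [Field K] [NumberField K] (W : WeierstrassCurve K) [W.IsElliptic]
  (p : ℕ) [Fact p.Prime]

/-- **Corank one and a point of infinite order pin the rank and `Ш[p^∞]`-corank.** For an elliptic
curve `E` over a number field `K` (model `W`) and a prime `p`: if `corank_{ℤ_p} Sel_{p^∞}(E/K) = 1`
and `rank E(K) ≥ 1` then `rank E(K) = 1` and `corank_{ℤ_p} Ш(E/K)[p^∞] = 0`, by the corank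
identity `corank Sel_{p^∞} = rank + corank Ш[p^∞]` (Greenberg 1999 §1; tree theorem
`selmerCorank_eq_mordellWeilRank_add_holds`) — "points first, `Ш` after" at `n = 1`
(`Literature.Barriers.BirchSwinnertonDyer.mordellWeilRank_eq_of_le_of_selmerCorank_le`).
[cite: Greenberg1999LNM, §1 pp. 54–57] -/
theorem mordellWeilRank_eq_one_and_shaCorank_eq_zero_of_selmerCorank_eq_one
    (hcorank : W.selmerCorank p = 1) (hpos : 1 ≤ W.mordellWeilRank) :
    W.mordellWeilRank = 1 ∧ W.shaCorank p = 0 := by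
  have h := W.selmerCorank_eq_mordellWeilRank_add_holds p
  omega

/-- **Corank one and a point of infinite order make `Ш(E/K)[p^∞]` finite** (and the rank `1`):
the squeeze `mordellWeilRank_eq_one_and_shaCorank_eq_zero_of_selmerCorank_eq_one` followed by
"`corank_{ℤ_p} Ш[p^∞] = 0 ⟹ Ш[p^∞]` finite" (`finite_primaryComponent_sha_iff_shaCorank_eq_zero`,
which rests on `#Ш(E/K)[p] < ∞`). [cite: Greenberg1999LNM, §1 pp. 54–57] -/
theorem mordellWeilRank_eq_one_and_finite_sha_primary_of_selmerCorank_eq_one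
    (hcorank : W.selmerCorank p = 1) (hpos : 1 ≤ W.mordellWeilRank) :
    W.mordellWeilRank = 1 ∧ Finite (AddCommGroup.primaryComponent W.sha p) := by
  obtain ⟨hr, h0⟩ :=
    mordellWeilRank_eq_one_and_shaCorank_eq_zero_of_selmerCorank_eq_one W p hcorank hpos
  exact ⟨hr, (finite_primaryComponent_sha_iff_shaCorank_eq_zero W p).2 h0⟩

/-- **Corank one and `Ш(E/K)[p^∞]` finite give rank one**: `corank Ш[p^∞] = 0` for a finite
`p`-primary group, so `rank = corank Sel_{p^∞} - 0 = 1` by the corank identity.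
[cite: Greenberg1999LNM, §1 pp. 54–57] -/
theorem mordellWeilRank_eq_one_of_selmerCorank_eq_one_of_finite_sha_primary
    (hcorank : W.selmerCorank p = 1) (hsha : Finite (AddCommGroup.primaryComponent W.sha p)) :
    W.mordellWeilRank = 1 := by
  have h := W.selmerCorank_eq_mordellWeilRank_add_holds p
  have h0 : W.shaCorank p = 0 := (finite_primaryComponent_sha_iff_shaCorank_eq_zero W p).1 hsha
  omega

/-- **An infinite Mordell–Weil group has positive rank** (Mordell–Weil plus the structure theorem:
`rank_ℤ E(K) = 0 ↔ E(K)` finite, tree theorem `mordellWeilRank_eq_zero_iff_finite`, Silverman AEC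
Thm. VIII.6.7). [cite: SilvermanAEC2009, Thm. VIII.6.7 and Ch. VIII intro] -/
theorem one_le_mordellWeilRank_of_infinite_point (h : Infinite W.toAffine.Point) :
    1 ≤ W.mordellWeilRank := by
  refine Nat.one_le_iff_ne_zero.mpr fun h0 ↦ ?_
  haveI : Finite W.toAffine.Point := W.mordellWeilRank_eq_zero_iff_finite.mp h0
  exact not_finite W.toAffine.Point

/-- **A curve of positive rank has infinitely many rational points** (the other direction of
`rank_ℤ E(K) = 0 ↔ E(K)` finite, `mordellWeilRank_eq_zero_iff_finite`).
[cite: SilvermanAEC2009, Thm. VIII.6.7 and Ch. VIII intro] -/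
theorem infinite_point_of_one_le_mordellWeilRank (h : 1 ≤ W.mordellWeilRank) :
    Infinite W.toAffine.Point := by
  refine not_finite_iff_infinite.mp fun hfin ↦ ?_
  have h0 : W.mordellWeilRank = 0 := W.mordellWeilRank_eq_zero_iff_finite.mpr hfin
  omega

end Squeeze

/-! ### The fact from Kim's Cor. 1.4 and (Ш₁) -/

section OverQ

/-- **The Yan–Zhu fact from Kim's Cor. 1.4 and positive rank in corank one.** If (i) Kim's
Cor. 1.4 holds (`hKim`, tree fact `kim_analyticRank_eq_one_of_mordellWeilRank_eq_one`: non-CM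
`E/ℚ`, `p > 3` good ordinary, `E[p]` irreducible, `rk_ℤ E(ℚ) = 1`, `#Ш(E/ℚ)[p^∞] < ∞ ⟹
ord_{s=1} L(E, s) = 1`) and (ii) every curve in the scope of the fact with
`corank_{ℤ_p} Sel_{p^∞}(E/ℚ) = 1` has `rank E(ℚ) ≥ 1` (`hpos`), then
`yanZhu_analyticRank_eq_one_of_selmerCorank_eq_one` holds. Proof: (ii) and the corank identity give
`rank = 1` and `Ш[p^∞]` finite
(`mordellWeilRank_eq_one_and_finite_sha_primary_of_selmerCorank_eq_one`); surjectivity of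
`ρ̄_{E,p}` at the good ordinary `p ≥ 5` gives "non-CM"
(`not_hasCM_of_hasSurjectiveModNGaloisRep_of_five_le`, Serre 1972 §4.5) and "`E[p]` irreducible"
(`hasIrreducibleModPGaloisRep_of_hasSurjectiveModNGaloisRep`); apply (i). The contrapositive of
(ii) is the "phantom Ш" configuration `rank E(ℚ) = 0`, `corank_{ℤ_p} Ш(E/ℚ)[p^∞] = 1`, which is
thus the whole content of the fact beyond Kim's Cor. 1.4.
[cite: Kim2022, Cor. 1.4] [cite: YanZhu2024MainConjNonCM, Cor. 1.4 (§1.1) and Thm. 4.15 (§4.6)]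
[cite: Greenberg1999LNM, §1 pp. 54–57] -/
theorem yanZhu_analyticRank_eq_one_of_selmerCorank_eq_one_of_kim_of_pos_rank
    (hKim : kim_analyticRank_eq_one_of_mordellWeilRank_eq_one)
    (hpos : ∀ (W : WeierstrassCurve ℚ) [W.IsElliptic] [W.IsGloballyMinimal] (p : ℕ) [Fact p.Prime],
      5 ≤ p → W.HasGoodReductionAtPrime p → ¬ (p : ℤ) ∣ W.frobeniusTrace p →
      W.HasSurjectiveModNGaloisRep p → W.selmerCorank p = 1 → 1 ≤ W.mordellWeilRank) :
    yanZhu_analyticRank_eq_one_of_selmerCorank_eq_one := by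
  intro W _ _ p _ hp hgood hord hsurj hcorank
  have hpP : p.Prime := Fact.out
  obtain ⟨hr, hsha⟩ := mordellWeilRank_eq_one_and_finite_sha_primary_of_selmerCorank_eq_one W p
    hcorank (hpos W p hp hgood hord hsurj hcorank)
  haveI : NeZero (p : ℚ) := ⟨by exact_mod_cast hpP.ne_zero⟩
  exact (hKim W (not_hasCM_of_hasSurjectiveModNGaloisRep_of_five_le W p hp hgood hord hsurj) p
    (by omega) hgood hord (hasIrreducibleModPGaloisRep_of_hasSurjectiveModNGaloisRep W p hsurj)
    hr hsha).1

/-- **The Yan–Zhu fact from Kim's Cor. 1.4 and (Ш₁)**: if Kim's Cor. 1.4 holds and every curve in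
the scope of the fact with `corank_{ℤ_p} Sel_{p^∞}(E/ℚ) = 1` has `Ш(E/ℚ)[p^∞]` finite, then the
fact holds — `Ш[p^∞]` finite and corank one give rank one
(`mordellWeilRank_eq_one_of_selmerCorank_eq_one_of_finite_sha_primary`), and
`yanZhu_analyticRank_eq_one_of_selmerCorank_eq_one_of_kim_of_pos_rank` applies.
[cite: Kim2022, Cor. 1.4] [cite: YanZhu2024MainConjNonCM, Cor. 1.4 (§1.1)]
[cite: Greenberg1999LNM, §1 pp. 54–57] -/
theorem yanZhu_analyticRank_eq_one_of_selmerCorank_eq_one_of_kim_of_finite_sha_primary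
    (hKim : kim_analyticRank_eq_one_of_mordellWeilRank_eq_one)
    (hsha : ∀ (W : WeierstrassCurve ℚ) [W.IsElliptic] [W.IsGloballyMinimal] (p : ℕ) [Fact p.Prime],
      5 ≤ p → W.HasGoodReductionAtPrime p → ¬ (p : ℤ) ∣ W.frobeniusTrace p →
      W.HasSurjectiveModNGaloisRep p → W.selmerCorank p = 1 →
      Finite (AddCommGroup.primaryComponent W.sha p)) :
    yanZhu_analyticRank_eq_one_of_selmerCorank_eq_one :=
  yanZhu_analyticRank_eq_one_of_selmerCorank_eq_one_of_kim_of_pos_rank hKim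
    fun W _ _ p _ hp hgood hord hsurj hc ↦
      (mordellWeilRank_eq_one_of_selmerCorank_eq_one_of_finite_sha_primary W p hc
        (hsha W p hp hgood hord hsurj hc)).ge

/-- **The Yan–Zhu fact from Kim's Cor. 1.4 and infinitely many rational points in corank one**:
if Kim's Cor. 1.4 holds and every curve in the scope of the fact with
`corank_{ℤ_p} Sel_{p^∞}(E/ℚ) = 1` has `E(ℚ)` infinite, then the fact holds (an infinite
Mordell–Weil group has positive rank, `one_le_mordellWeilRank_of_infinite_point`).
[cite: Kim2022, Cor. 1.4] [cite: YanZhu2024MainConjNonCM, Cor. 1.4 (§1.1)]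
[cite: SilvermanAEC2009, Thm. VIII.6.7] -/
theorem yanZhu_analyticRank_eq_one_of_selmerCorank_eq_one_of_kim_of_infinite_point
    (hKim : kim_analyticRank_eq_one_of_mordellWeilRank_eq_one)
    (hinf : ∀ (W : WeierstrassCurve ℚ) [W.IsElliptic] [W.IsGloballyMinimal] (p : ℕ) [Fact p.Prime],
      5 ≤ p → W.HasGoodReductionAtPrime p → ¬ (p : ℤ) ∣ W.frobeniusTrace p →
      W.HasSurjectiveModNGaloisRep p → W.selmerCorank p = 1 → Infinite W.toAffine.Point) :
    yanZhu_analyticRank_eq_one_of_selmerCorank_eq_one :=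
  yanZhu_analyticRank_eq_one_of_selmerCorank_eq_one_of_kim_of_pos_rank hKim
    fun W _ _ p _ hp hgood hord hsurj hc ↦
      one_le_mordellWeilRank_of_infinite_point W (hinf W p hp hgood hord hsurj hc)

/-! ### Conversely: what the fact gives back through Gross–Zagier–Kolyvagin -/

/-- **In corank one the fact yields rank one and finite `Ш`.** If
`yanZhu_analyticRank_eq_one_of_selmerCorank_eq_one` holds (`h`) and Gross–Zagier–Kolyvagin over
`ℚ` holds (`hGZK`, tree fact `rank_eq_analyticRank_of_analyticRank_le_one`: `ord_{s=1} L(E, s) ≤ 1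
⟹ rank E(ℚ) = ord_{s=1} L(E, s)` and `Ш(E/ℚ)` finite; Darmon 2004, Thm. 3.22), then every curve
in the scope of the fact with `corank_{ℤ_p} Sel_{p^∞}(E/ℚ) = 1` has `rank E(ℚ) = 1` and `Ш(E/ℚ)`
finite: the fact gives `ord_{s=1} L(E, s) = 1 ≤ 1`. (This is how Yan–Zhu's Cor. 1.4 (3) ⟹ (1) and
BCGS's Cor. 1 are completed to `rank = 1`, `#Ш < ∞` in print.)
[cite: YanZhu2024MainConjNonCM, Cor. 1.4 (§1.1)] [cite: Darmon2004, Thm. 3.22 (= Thm. 1.14)] -/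
theorem mordellWeilRank_eq_one_and_finite_sha_of_yanZhu_of_gzk
    (h : yanZhu_analyticRank_eq_one_of_selmerCorank_eq_one)
    (hGZK : rank_eq_analyticRank_of_analyticRank_le_one)
    (W : WeierstrassCurve ℚ) [W.IsElliptic] [W.IsGloballyMinimal] (p : ℕ) [Fact p.Prime]
    (hp : 5 ≤ p) (hgood : W.HasGoodReductionAtPrime p) (hord : ¬ (p : ℤ) ∣ W.frobeniusTrace p)
    (hsurj : W.HasSurjectiveModNGaloisRep p) (hcorank : W.selmerCorank p = 1) :
    W.mordellWeilRank = 1 ∧ Finite W.sha := by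
  have h1 : W.analyticRank = 1 := h W p hp hgood hord hsurj hcorank
  obtain ⟨hr, hfin⟩ := hGZK W h1.le
  exact ⟨hr.trans h1, hfin⟩

/-! ### The equivalences: modulo Kim's Cor. 1.4 and Gross–Zagier–Kolyvagin, the fact is (Ш₁) -/

/-- **The fact ⟺ `Ш(E/ℚ)[p^∞]` finite in corank one**, modulo Kim's Cor. 1.4 (`hKim`) and
Gross–Zagier–Kolyvagin over `ℚ` (`hGZK`): `yanZhu_analyticRank_eq_one_of_selmerCorank_eq_one` holds
iff every `E/ℚ` (globally minimal `W`) with a prime `p ≥ 5` of good ordinary reduction,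
`ρ̄_{E,p}` surjective and `corank_{ℤ_p} Sel_{p^∞}(E/ℚ) = 1` has `Ш(E/ℚ)[p^∞]` finite.
(⟹: `mordellWeilRank_eq_one_and_finite_sha_of_yanZhu_of_gzk` gives all of `Ш(E/ℚ)` finite;
⟸: `yanZhu_analyticRank_eq_one_of_selmerCorank_eq_one_of_kim_of_finite_sha_primary`.) So the
`K`-level Kolyvagin-system input of the printed proofs (BCGS Thm. A / the Heegner point main
conjecture) serves over `ℚ` exactly to remove the hypothesis `#Ш(E/ℚ)[p^∞] < ∞` from Kim's
Cor. 1.4. [cite: Kim2022, Cor. 1.4 and Remark 2.11] [cite: BurungaleEtAl2026, Cor. 1 and Thm. A (§0.1)]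
[cite: YanZhu2024MainConjNonCM, Cor. 1.4 (§1.1)] [cite: Darmon2004, Thm. 3.22] -/
theorem yanZhu_analyticRank_eq_one_of_selmerCorank_eq_one_iff_finite_sha_primary
    (hKim : kim_analyticRank_eq_one_of_mordellWeilRank_eq_one)
    (hGZK : rank_eq_analyticRank_of_analyticRank_le_one) :
    yanZhu_analyticRank_eq_one_of_selmerCorank_eq_one ↔
      ∀ (W : WeierstrassCurve ℚ) [W.IsElliptic] [W.IsGloballyMinimal] (p : ℕ) [Fact p.Prime],
        5 ≤ p → W.HasGoodReductionAtPrime p → ¬ (p : ℤ) ∣ W.frobeniusTrace p →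
        W.HasSurjectiveModNGaloisRep p → W.selmerCorank p = 1 →
        Finite (AddCommGroup.primaryComponent W.sha p) := by
  refine ⟨fun h W _ _ p _ hp hgood hord hsurj hc ↦ ?_,
    yanZhu_analyticRank_eq_one_of_selmerCorank_eq_one_of_kim_of_finite_sha_primary hKim⟩
  haveI : Finite W.sha :=
    (mordellWeilRank_eq_one_and_finite_sha_of_yanZhu_of_gzk h hGZK W p hp hgood hord hsurj hc).2
  infer_instance

/-- **The fact ⟺ positive rank in corank one**, modulo Kim's Cor. 1.4 and Gross–Zagier–Kolyvagin:
`yanZhu_analyticRank_eq_one_of_selmerCorank_eq_one` holds iff every curve in its scope with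
`corank_{ℤ_p} Sel_{p^∞}(E/ℚ) = 1` has `rank E(ℚ) ≥ 1` — i.e. iff the "phantom Ш" configuration
`rank E(ℚ) = 0`, `Ш(E/ℚ)[p^∞] ⊇ ℚ_p/ℤ_p` does not occur in that scope. This is the corank-one
evasion of the catalogued barrier `Literature.Barriers.BirchSwinnertonDyer.SelmerRankBarrier`
("`p`-converse theorems that turn `corank Sel_{p^∞} = 1` into a non-torsion point without
assuming `Ш` finite", W. Zhang 2014 Thms. 1.3–1.4, Skinner 2020), stated as an equivalence.
[cite: WZhang2014, p. 193 and Thms. 1.3–1.4] [cite: Kim2022, Cor. 1.4]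
[cite: YanZhu2024MainConjNonCM, Cor. 1.4 (§1.1)] [cite: Darmon2004, Thm. 3.22] -/
theorem yanZhu_analyticRank_eq_one_of_selmerCorank_eq_one_iff_pos_rank
    (hKim : kim_analyticRank_eq_one_of_mordellWeilRank_eq_one)
    (hGZK : rank_eq_analyticRank_of_analyticRank_le_one) :
    yanZhu_analyticRank_eq_one_of_selmerCorank_eq_one ↔
      ∀ (W : WeierstrassCurve ℚ) [W.IsElliptic] [W.IsGloballyMinimal] (p : ℕ) [Fact p.Prime],
        5 ≤ p → W.HasGoodReductionAtPrime p → ¬ (p : ℤ) ∣ W.frobeniusTrace p →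
        W.HasSurjectiveModNGaloisRep p → W.selmerCorank p = 1 → 1 ≤ W.mordellWeilRank :=
  ⟨fun h W _ _ p _ hp hgood hord hsurj hc ↦
      (mordellWeilRank_eq_one_and_finite_sha_of_yanZhu_of_gzk h hGZK W p hp hgood hord hsurj hc).1.ge,
    yanZhu_analyticRank_eq_one_of_selmerCorank_eq_one_of_kim_of_pos_rank hKim⟩

/-- **The fact ⟺ infinitely many rational points in corank one**, modulo Kim's Cor. 1.4 and
Gross–Zagier–Kolyvagin: `yanZhu_analyticRank_eq_one_of_selmerCorank_eq_one` holds iff every curve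
in its scope with `corank_{ℤ_p} Sel_{p^∞}(E/ℚ) = 1` has `E(ℚ)` infinite (Mordell–Weil:
`rank = 0 ↔ E(ℚ)` finite). [cite: Kim2022, Cor. 1.4] [cite: YanZhu2024MainConjNonCM, Cor. 1.4 (§1.1)]
[cite: Darmon2004, Thm. 3.22] [cite: SilvermanAEC2009, Thm. VIII.6.7] -/
theorem yanZhu_analyticRank_eq_one_of_selmerCorank_eq_one_iff_infinite_point
    (hKim : kim_analyticRank_eq_one_of_mordellWeilRank_eq_one)
    (hGZK : rank_eq_analyticRank_of_analyticRank_le_one) :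
    yanZhu_analyticRank_eq_one_of_selmerCorank_eq_one ↔
      ∀ (W : WeierstrassCurve ℚ) [W.IsElliptic] [W.IsGloballyMinimal] (p : ℕ) [Fact p.Prime],
        5 ≤ p → W.HasGoodReductionAtPrime p → ¬ (p : ℤ) ∣ W.frobeniusTrace p →
        W.HasSurjectiveModNGaloisRep p → W.selmerCorank p = 1 → Infinite W.toAffine.Point :=
  ⟨fun h W _ _ p _ hp hgood hord hsurj hc ↦ infinite_point_of_one_le_mordellWeilRank W
      (mordellWeilRank_eq_one_and_finite_sha_of_yanZhu_of_gzk h hGZK W p hp hgood hord hsurj hc).1.ge,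
    yanZhu_analyticRank_eq_one_of_selmerCorank_eq_one_of_kim_of_infinite_point hKim⟩

/-- **The fact ⟺ equality in the Selmer bound `rank E(ℚ) ≤ corank_{ℤ_p} Sel_{p^∞}(E/ℚ)` in corank
one**, modulo Kim's Cor. 1.4 and Gross–Zagier–Kolyvagin — the form in which the barrier
`Literature.Barriers.BirchSwinnertonDyer.SelmerRankBarrier` states the wall (`rank ≤ corank Sel_{p^∞}`,
with equality iff `corank Ш[p^∞] = 0`; W. Zhang 2014, p. 193).
[cite: WZhang2014, p. 193] [cite: Kim2022, Cor. 1.4] [cite: YanZhu2024MainConjNonCM, Cor. 1.4 (§1.1)]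
[cite: Darmon2004, Thm. 3.22] -/
theorem yanZhu_analyticRank_eq_one_of_selmerCorank_eq_one_iff_mordellWeilRank_eq_selmerCorank
    (hKim : kim_analyticRank_eq_one_of_mordellWeilRank_eq_one)
    (hGZK : rank_eq_analyticRank_of_analyticRank_le_one) :
    yanZhu_analyticRank_eq_one_of_selmerCorank_eq_one ↔
      ∀ (W : WeierstrassCurve ℚ) [W.IsElliptic] [W.IsGloballyMinimal] (p : ℕ) [Fact p.Prime],
        5 ≤ p → W.HasGoodReductionAtPrime p → ¬ (p : ℤ) ∣ W.frobeniusTrace p →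
        W.HasSurjectiveModNGaloisRep p → W.selmerCorank p = 1 →
        W.mordellWeilRank = W.selmerCorank p := by
  refine ⟨fun h W _ _ p _ hp hgood hord hsurj hc ↦ ?_, fun heq ↦
    yanZhu_analyticRank_eq_one_of_selmerCorank_eq_one_of_kim_of_pos_rank hKim
      fun W _ _ p _ hp hgood hord hsurj hc ↦ ?_⟩
  · rw [hc]
    exact (mordellWeilRank_eq_one_and_finite_sha_of_yanZhu_of_gzk h hGZK W p hp hgood hord hsurj hc).1
  · have he := heq W p hp hgood hord hsurj hc
    omega

end OverQ

end Literature.NumberTheory.EllipticCurves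

end
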